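import Summits.BirchSwinnertonDyer.BirchSwinnertonDyer.Theorems.Rank1ResidualJetCebotarevAdapter
import Summits.BirchSwinnertonDyer.BirchSwinnertonDyer.Theorems.Rank1ResidualJetRingClassFields
import Summits.BirchSwinnertonDyer.BirchSwinnertonDyer.Theorems.Rank1ResidualJetCompatibleData
import Literature.NumberTheory.EllipticCurves.HeegnerPointsOfConductorRationalityProofs
import Literature.NumberTheory.EllipticCurves.RingClassGalOverCyclicProofs
import HarnessLib

/-!
# The walk's input `h47` DISCHARGED modulo McCallum Prop. 4.4 alone: a data system on the admissible
# conductors, COMPATIBLE along increasing prime chains above the base conductor, built by recursion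
# from the given datum (cell `bsd-stepL`, seat `bsd-stepL-tam3-p1`, helper toward item 19109
# `EulerHalvesAtThree`, registered stub `stub_jetchevMaxHLAtThree`)

HONEST FRAMING. Nothing here proves BSD, J₃ or any divisibility of a Heegner point; the registered stub
is NOT discharged; no item closes; 0 classes move (T7); `--supports stmt-BirchSwinnertonDyer-19109`
(helper). WHAT THIS FILE DOES. (1) `Walk.exists_basedFamily_of_primeStep` — pure combinatorics: given a
type of "data" at every natural number, nonempty at every admissible number, and a ONE-PRIME-STEP
extension `c ↦ c·ℓ` satisfying a relation `R`, there is a family `D` on the admissible numbers with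
`D n = d` (the given datum) and `R (D s) (D (sℓ))` for every multiple `s` of `n` and every prime `ℓ`
above all prime factors of `s` (recursion on `s`, peeling the LARGEST prime of `s/n`). (2)
`Koly.exists_data_h47Base_of_prop44` — the instantiation: data = `KolyvaginHeegnerData Dt β ι`, `R` =
McCallum's four compatibility clauses (`σ`, `S` both ways, `emb`), the step = bsd-jet's
`JET.exists_compatible_data_of_grossCM` (with the tree's PROVED Gross §3 facts
`phi_heegnerPointOfConductor_mem_range_map_ringClassField_holds`,
`exists_generator_ringClassGalOver_holds` feeding it and `nonempty_kolyvaginHeegnerData_of_grossCM`);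
conclusion: from ANY datum `d` at an admissible conductor `n` there is a data system `D` on the
admissible-conductor subtype with `D n = d` satisfying the hypothesis `h47` of
`Koly.tamagawaExponent_le_m_of_orderedFamiliesBase` (p509933) ∕ the conjunct `h47` of
`Koly.jetchevMaxHLAtThree_of_facts_of_orderedSupply` VERBATIM (with `c := n`), CONDITIONAL only on the
typed print fact `h44 : McCallum1991.prop44_localOrder_kolyvaginClass_mul_eq` (via bsd-jet's
`JET.addOrderOf_localization_kolyvaginClass_mul_eq_of_prop44`). This is why the walk was re-cut to ask
`h47` only at multiples of the base conductor and only for primes above it (memo MEMO-J3-v5 §4.2 (a)).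
References (locators only; no cited FACT declared): [cite: McCallumLMS1991, §4 (p. 300: σ_l, S, P_n),
Prop. 4.4 (p. 301)] [cite: GrossLMS1991, §3 (pp. 238–239), §4 (4.1)] [cite: Jetchev2008, §4.1
(p. 818), Prop. 4.4 (p. 821) = arXiv Prop. 4.7]. Design: theorems only, no definitions; `K : Type`.
Axioms: `propext`, `Classical.choice`, `Quot.sound`.
-/

set_option autoImplicit false

noncomputable section

open scoped Classical NumberField

namespace Summit.BirchSwinnertonDyer.Rank1Residual.JET.Walk

/-- **A based family from a one-prime-step extension** (the recursion behind "one coherent system of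
choices read at all levels", Gross §3–§4 ∕ McCallum §4). `A` = admissibility (hereditary, implies
square-free), `data m` nonempty for admissible `m`, and every datum at `c` extends to `c·ℓ` (admissible,
`ℓ` prime) in the relation `R`. Then for a datum `d` at an admissible `n` there is a family `D` on
`{m // A m}` with `D n = d` and `R (D s) (D s')` whenever `n ∣ s`, `s' = s·ℓ`, `ℓ` a prime above every
prime factor of `s`. Construction: `D s := d` if `s = n`; if `n ∣ s ≠ n`, the extension of `D (s/L)`
by the largest prime `L` of `s/n`; any datum otherwise. [cite: GrossLMS1991, §3 (pp. 238–239)]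
[cite: McCallumLMS1991, §4 (p. 300)] -/
theorem exists_basedFamily_of_primeStep {data : ℕ → Type*} (A : ℕ → Prop)
    (R : ∀ {a b : ℕ}, data a → data b → Prop)
    (hAsq : ∀ m, A m → Squarefree m) (hAdvd : ∀ m m', A m → m' ∣ m → A m')
    (hne : ∀ m, A m → Nonempty (data m))
    (hext : ∀ (c ℓ : ℕ) (dc : data c), A (c * ℓ) → ℓ.Prime → ∃ d' : data (c * ℓ), R dc d')
    {n : ℕ} (hn : A n) (d : data n) :
    ∃ D : ∀ s : {m // A m}, data s.1, D ⟨n, hn⟩ = d ∧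
      ∀ (s s' : {m // A m}) (ℓ : ℕ), ℓ.Prime → ¬ ℓ ∣ s.1 → s'.1 = s.1 * ℓ →
        (∀ q ∈ s.1.primeFactors, q < ℓ) → n ∣ s.1 → R (D s) (D s') := by
  -- extension to any target `m' = c·ℓ` (no transport later)
  have hext' : ∀ (c : ℕ) (dc : data c) (ℓ m' : ℕ), c * ℓ = m' → A m' → ℓ.Prime →
      ∃ d' : data m', R dc d' := by
    intro c dc ℓ m' e hA hℓ
    subst e
    exact hext c ℓ dc hA hℓ
  have hn0 : n ≠ 0 := (hAsq n hn).ne_zero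
  -- the recursion step
  let body : ∀ m : ℕ, (∀ m', m' < m → A m' → data m') → A m → data m := fun m IH h ↦
    if hm : m = n then hm ▸ d else
    if hdn : n ∣ m ∧ (m / n).primeFactors.Nonempty then
      have hLmem : (m / n).primeFactors.max' hdn.2 ∈ (m / n).primeFactors := Finset.max'_mem _ _
      have hL : ((m / n).primeFactors.max' hdn.2).Prime := Nat.prime_of_mem_primeFactors hLmem
      have hLm : (m / n).primeFactors.max' hdn.2 ∣ m :=
        (Nat.dvd_of_mem_primeFactors hLmem).trans (Nat.div_dvd_of_dvd hdn.1)
      have hlt : m / (m / n).primeFactors.max' hdn.2 < m :=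
        Nat.div_lt_self (Nat.pos_of_ne_zero (hAsq m h).ne_zero) hL.one_lt
      have hA' : A (m / (m / n).primeFactors.max' hdn.2) := hAdvd m _ h (Nat.div_dvd_of_dvd hLm)
      Classical.choose (hext' _ (IH _ hlt hA') _ m (Nat.div_mul_cancel hLm) h hL)
    else (hne m h).some
  let G : ∀ m : ℕ, A m → data m := Nat.strongRec (motive := fun m ↦ A m → data m) body
  have hG : ∀ m : ℕ, G m = body m (fun m' _ ↦ G m') := fun m ↦ Nat.strongRec_eq body m
  refine ⟨fun s ↦ G s.1 s.2, ?_, ?_⟩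
  · -- the base value
    show G n hn = d
    rw [hG]
    simp only [body, dif_pos rfl]
  · intro s s' ℓ hℓ hℓs hs' hlt hns
    obtain ⟨m', hm'⟩ := s'
    change m' = s.1 * ℓ at hs'
    subst hs'
    show R (G s.1 s.2) (G (s.1 * ℓ) hm')
    have hs0 : s.1 ≠ 0 := (hAsq _ s.2).ne_zero
    have hsl0 : s.1 * ℓ ≠ 0 := mul_ne_zero hs0 hℓ.ne_zero
    have hne_n : ¬ s.1 * ℓ = n := by
      intro h
      have h1 : n ≤ s.1 := Nat.le_of_dvd (Nat.pos_of_ne_zero hs0) hns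
      have h2 : s.1 < s.1 * ℓ := lt_mul_of_one_lt_right (Nat.pos_of_ne_zero hs0) hℓ.one_lt
      omega
    have hℓmem : ℓ ∈ (s.1 * ℓ / n).primeFactors := by
      obtain ⟨t, ht⟩ := hns
      have hst : s.1 * ℓ / n = t * ℓ := by
        rw [ht, mul_assoc, Nat.mul_div_cancel_left _ (Nat.pos_of_ne_zero hn0)]
      rw [hst, Nat.mem_primeFactors]
      refine ⟨hℓ, dvd_mul_left ℓ t, ?_⟩
      rw [← hst]
      intro h0
      rw [Nat.div_eq_zero_iff] at h0
      rcases h0 with h0 | h0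
      · exact hn0 h0
      · have h1 : n ≤ s.1 := Nat.le_of_dvd (Nat.pos_of_ne_zero hs0) ⟨t, ht⟩
        have h2 : s.1 ≤ s.1 * ℓ := Nat.le_mul_of_pos_right _ hℓ.pos
        omega
    have hdn : n ∣ s.1 * ℓ ∧ (s.1 * ℓ / n).primeFactors.Nonempty := ⟨hns.mul_right ℓ, ⟨ℓ, hℓmem⟩⟩
    have hL : (s.1 * ℓ / n).primeFactors.max' hdn.2 = ℓ := by
      refine le_antisymm (Finset.max'_le _ _ _ fun q hq ↦ ?_) (Finset.le_max' _ ℓ hℓmem)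
      have hq' : q ∈ (s.1 * ℓ).primeFactors :=
        Nat.primeFactors_mono (Nat.div_dvd_of_dvd hdn.1) hsl0 hq
      rw [Nat.primeFactors_mul hs0 hℓ.ne_zero, Finset.mem_union, hℓ.primeFactors,
        Finset.mem_singleton] at hq'
      rcases hq' with hq' | rfl
      · exact (hlt q hq').le
      · exact le_rfl
    -- unfold the recursion once at `s·ℓ`
    rw [hG (s.1 * ℓ)]
    simp only [body, dif_neg hne_n, dif_pos hdn]
    -- the chosen extension is `R`-related to the datum it extends, which is `D s`
    have key : ∀ (L a : ℕ) (ha : A a) (e : a * L = s.1 * ℓ) (hL' : L.Prime), a = s.1 →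
        R (G s.1 s.2) (Classical.choose (hext' a (G a ha) L (s.1 * ℓ) e hm' hL')) := by
      intro L a ha e hL' hae
      subst hae
      exact Classical.choose_spec (hext' s.1 (G s.1 ha) L (s.1 * ℓ) e hm' hL')
    have hLdvd : (s.1 * ℓ / n).primeFactors.max' hdn.2 ∣ s.1 * ℓ := by
      rw [hL]; exact dvd_mul_left ℓ s.1
    have hLp : ((s.1 * ℓ / n).primeFactors.max' hdn.2).Prime := by rw [hL]; exact hℓ
    have ha : s.1 * ℓ / (s.1 * ℓ / n).primeFactors.max' hdn.2 = s.1 := by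
      rw [hL]; exact Nat.mul_div_cancel s.1 hℓ.pos
    exact key _ _ (hAdvd _ _ hm' (Nat.div_dvd_of_dvd hLdvd)) (Nat.div_mul_cancel hLdvd) hLp ha

end Summit.BirchSwinnertonDyer.Rank1Residual.JET.Walk

namespace Summit.BirchSwinnertonDyer.Rank1Residual.X11b.Three.Koly

open WeierstrassCurve IsDedekindDomain NumberField Literature.NumberTheory.EllipticCurves
  Literature.NumberTheory.EllipticCurves.ModularForms Literature.NumberTheory.GaloisRepresentations
  Summit.BirchSwinnertonDyer.Rank1Residual.JET

/-- **`h47` of the based ordered walk, DISCHARGED modulo McCallum Prop. 4.4.** For `W` non-CM, `K`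
imaginary quadratic with `d_K < −4` and the Heegner hypothesis, `p` odd with the `p`-adic tower, a
frame `(Dt, β, ι)`, a level `p^k` (`k ≥ 1`) and ANY datum `d` at an admissible conductor `n`: there
is a data system `D` on the admissible-conductor subtype with `D n = d` such that for every multiple
`s` of `n`, every prime `ℓ ∤ s` above all prime factors of `s` with `sℓ` admissible, and `λ ∋ ℓ`, the
localisations at `λ` of `c_k(sℓ)` and `c_k(s)` have the same order — the hypothesis `h47` of
`Koly.tamagawaExponent_le_m_of_orderedFamiliesBase` VERBATIM (`c := n`). The data are Gross's one
system of choices built by `Walk.exists_basedFamily_of_primeStep` from bsd-jet's compatible one-step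
extension; the comparison is the typed Prop. 4.4 (`h44`, print, hypothesis).
[cite: McCallumLMS1991, §4 Prop. 4.4 (p. 301)] [cite: GrossLMS1991, §3 (pp. 238–239), §4 (4.1)]
[cite: Jetchev2008, Prop. 4.4 (p. 821)] -/
theorem exists_data_h47Base_of_prop44
    (h44 : McCallum1991.prop44_localOrder_kolyvaginClass_mul_eq)
    (W : WeierstrassCurve ℚ) [W.IsElliptic] [W.IsGloballyMinimal] [NeZero (W.conductorNorm ℤ)]
    (hcm : ¬ W.HasCM) {K : Type} [Field K] [NumberField K] (hK : IsImaginaryQuadratic K)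
    (hD : NumberField.discr K < -4) (hH : SatisfiesHeegnerHypothesis (W.conductorNorm ℤ) K)
    {p : ℕ} [Fact p.Prime] (hp2 : p ≠ 2) (htower : ∀ n : ℕ, W.HasSurjectiveModNGaloisRep (p ^ n : ℕ))
    (Dt : ModularParametrizationData W (W.conductorNorm ℤ)) (β : ℤ) (ι : K →+* ℂ) {k : ℕ} (hk : 1 ≤ k)
    {n : ℕ} (hn : Squarefree n ∧ ∀ q ∈ n.primeFactors,
      Zhang2014.IsKolyvaginPrime (W.conductorNorm ℤ) W K p q ∧ k ≤ Zhang2014.kolyvaginIndex W p q)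
    (d : KolyvaginHeegnerData Dt β ι n) :
    ∃ D : ∀ s : {m : ℕ // Squarefree m ∧ ∀ q ∈ m.primeFactors,
        Zhang2014.IsKolyvaginPrime (W.conductorNorm ℤ) W K p q ∧ k ≤ Zhang2014.kolyvaginIndex W p q},
        KolyvaginHeegnerData Dt β ι s.1, D ⟨n, hn⟩ = d ∧
      ∀ (s s' : {m : ℕ // Squarefree m ∧ ∀ q ∈ m.primeFactors,
        Zhang2014.IsKolyvaginPrime (W.conductorNorm ℤ) W K p q ∧ k ≤ Zhang2014.kolyvaginIndex W p q})
        (ℓ : ℕ), ℓ.Prime → ¬ ℓ ∣ s.1 → s'.1 = s.1 * ℓ → (∀ q ∈ s.1.primeFactors, q < ℓ) → n ∣ s.1 →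
      ∀ v : HeightOneSpectrum (𝓞 K), (ℓ : 𝓞 K) ∈ v.asIdeal →
      addOrderOf (galoisCohomology.localization ((W.baseChange K).torsionGaloisModule ((p ^ k : ℕ) : ℤ))
          (Sum.inr v) 1 ((D s').kolyvaginClass (Fact.out : p.Prime) k)) =
        addOrderOf (galoisCohomology.localization ((W.baseChange K).torsionGaloisModule ((p ^ k : ℕ) : ℤ))
          (Sum.inr v) 1 ((D s).kolyvaginClass (Fact.out : p.Prime) k)) := by
  haveI : ∀ j : ℕ, NumberField (ringClassField K ι j) := numberField_ringClassField K hK ι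
  have hD3 : NumberField.discr K ≠ -3 := by omega
  have hD4 : NumberField.discr K ≠ -4 := by omega
  -- the based family of compatible data
  obtain ⟨D, hDn, hR⟩ := Walk.exists_basedFamily_of_primeStep
    (data := fun m ↦ KolyvaginHeegnerData Dt β ι m)
    (fun m ↦ Squarefree m ∧ ∀ q ∈ m.primeFactors,
      Zhang2014.IsKolyvaginPrime (W.conductorNorm ℤ) W K p q ∧ k ≤ Zhang2014.kolyvaginIndex W p q)
    (R := fun {a b} (dc : KolyvaginHeegnerData Dt β ι a) (d' : KolyvaginHeegnerData Dt β ι b) ↦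
      (∀ l' ∈ a.primeFactors, ∀ (x : ringClassField K ι a) (x' : ringClassField K ι b),
        (x : ℂ) = x' → ((d'.σ l' x' : ringClassField K ι b) : ℂ) = (dc.σ l' x : ℂ)) ∧
      (∀ t ∈ dc.S, ∃ t' ∈ d'.S, ∀ (x : ringClassField K ι a) (x' : ringClassField K ι b),
        (x : ℂ) = x' → ((t' x' : ringClassField K ι b) : ℂ) = (t x : ℂ)) ∧
      (∀ t' ∈ d'.S, ∃ t ∈ dc.S, ∀ (x : ringClassField K ι a) (x' : ringClassField K ι b),
        (x : ℂ) = x' → ((t' x' : ringClassField K ι b) : ℂ) = (t x : ℂ)) ∧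
      (∀ (x : ringClassField K ι a) (x' : ringClassField K ι b),
        (x : ℂ) = x' → d'.emb x' = dc.emb x))
    (fun m h ↦ h.1) (fun m m' h hm' ↦ ⟨h.1.squarefree_of_dvd hm', fun q hq ↦
      h.2 q (Nat.primeFactors_mono hm' h.1.ne_zero hq)⟩)
    (fun m h ↦ BirchSwinnertonDyer.Theorems.nonempty_kolyvaginHeegnerData_of_grossCM
      (phi_heegnerPointOfConductor_mem_range_map_ringClassField_holds _ W K)
      exists_generator_ringClassGalOver_holds hK hH Dt β ι d.dvd_sq_sub h.1
      (fun q hq ↦ (h.2 q hq).1.2.2.2.2.1))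
    (fun c ℓ dc hA hℓ ↦ by
      have hc0 : c * ℓ ≠ 0 := hA.1.ne_zero
      obtain ⟨hcop, hc, -⟩ := Nat.squarefree_mul_iff.mp hA.1
      have hcK : ∀ q ∈ c.primeFactors, Zhang2014.IsKolyvaginPrime (W.conductorNorm ℤ) W K p q :=
        fun q hq ↦ (hA.2 q (Nat.primeFactors_mono (dvd_mul_right c ℓ) hc0 hq)).1
      have hKol : Zhang2014.IsKolyvaginPrime (W.conductorNorm ℤ) W K p ℓ :=
        (hA.2 ℓ (Nat.mem_primeFactors.mpr ⟨hℓ, dvd_mul_left ℓ c, hc0⟩)).1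
      have hℓc : ℓ ∉ c.primeFactors := fun h ↦
        (Nat.Prime.coprime_iff_not_dvd hℓ).mp hcop.symm (Nat.dvd_of_mem_primeFactors h)
      obtain ⟨dℓ, hdℓ⟩ := exists_compatible_data_of_grossCM
        (phi_heegnerPointOfConductor_mem_range_map_ringClassField_holds _ W K) hK hD hH p Dt β ι hc
        hcK dc
      exact ⟨dℓ ℓ hKol hℓc, hdℓ ℓ hKol hℓc⟩)
    hn d
  refine ⟨D, hDn, ?_⟩
  intro s s' ℓ hℓ hℓs hs' hlt hns v hv
  obtain ⟨hσ, hS1, hS2, hemb⟩ := hR s s' ℓ hℓ hℓs hs' hlt hns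
  -- transport the datum at `s'` along `s'.1 = s.1 * ℓ`
  obtain ⟨m', hm'⟩ := s'
  change m' = s.1 * ℓ at hs'
  subst hs'
  exact addOrderOf_localization_kolyvaginClass_mul_eq_of_prop44 h44 W hcm K hK hD3 hD4 hH p hp2 htower
    Dt β ι k hk s.1 ℓ hm'.1 hℓ hℓs hm'.2 (D s) (D ⟨s.1 * ℓ, hm'⟩) hσ hS1 hS2 hemb v hv

end Summit.BirchSwinnertonDyer.Rank1Residual.X11b.Three.Koly

end
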